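import Mathlib.GroupTheory.GroupAction.Quotient
import Mathlib.Algebra.Group.Action.Prod
import Mathlib.Algebra.Order.BigOperators.Group.Finset
import Mathlib.Data.Fintype.Prod
import HarnessLib

/-!
# Ring 2 / AbelianAll — fibre partners under a transitive monodromy group (WEIL-2 gen 63, LEMMA C)

research route, not a corollary; conditional on HC_CM plus one named minimal statement.
`HC_CM` occurs nowhere in this file; nothing here is a case of the Hodge conjecture.

Fact-free group-theoretic core of LEMMA C of the account `FIBRE-G63.md` (pub-hodge-ring2, seat
ab-weil-2, gen 63).  In the finite-field injectivity census for the degree `δ̄` of Schoen's packet map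
`Q → Ẑ`, the `𝔽_q`-rational points of a fibre are the fixed points of its Frobenius element in the
monodromy group `G ⊆ Sym(fibre)`, and the rational points are weighted by `|Fix g|`.  If `δ̄ ≥ 2` and
`G` is transitive, Burnside's lemma on `X` and on `X × X` gives

  `∑_g |Fix g| = |G|`  and  `∑_g |Fix g|² = #(orbits on X × X)·|G| ≥ 2|G|`,

so `∑_g |Fix g|·(|Fix g| - 1) ≥ ∑_g |Fix g|`: averaged over rational points, every point has at least
one OTHER rational point in its fibre (`two_mul_sum_card_fixedBy_le_sum_sq`).  This is what makes
"no collisions among all rational packet points" incompatible with `δ̄ ≥ 2` (when the Frobenius lies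
in the geometric monodromy group).
-/

namespace Summit.HodgeConjecture.Ring2AbelianAll.FibrePartners

open MulAction

variable (G X : Type*) [Group G] [MulAction G X]

/-- A pair is fixed by `g` iff both coordinates are. -/
theorem mem_fixedBy_prod_iff (g : G) (p : X × X) :
    p ∈ fixedBy (X × X) g ↔ p.1 ∈ fixedBy X g ∧ p.2 ∈ fixedBy X g := by
  simp only [mem_fixedBy, Prod.ext_iff, Prod.smul_fst, Prod.smul_snd]

/-- `|Fix_{X×X}(g)| = |Fix_X(g)|²` (via the evident bijection `Fix_{X×X}(g) ≃ Fix_X(g) × Fix_X(g)`,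
built inside the proof). -/
theorem card_fixedBy_prod (g : G) [Fintype (fixedBy X g)] [Fintype (fixedBy (X × X) g)] :
    Fintype.card (fixedBy (X × X) g) = Fintype.card (fixedBy X g) ^ 2 := by
  rw [sq, ← Fintype.card_prod]
  refine Fintype.card_congr ?_
  exact
    { toFun := fun p => ⟨⟨p.1.1, ((mem_fixedBy_prod_iff G X g p.1).1 p.2).1⟩,
                         ⟨p.1.2, ((mem_fixedBy_prod_iff G X g p.1).1 p.2).2⟩⟩
      invFun := fun q => ⟨(q.1.1, q.2.1), (mem_fixedBy_prod_iff G X g _).2 ⟨q.1.2, q.2.2⟩⟩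
      left_inv := fun p => by ext <;> rfl
      right_inv := fun q => by ext <;> rfl }

/-- The diagonal and an off-diagonal pair lie in different orbits of `G` on `X × X`; so if `X` has two
distinct points there are at least two orbits. -/
theorem two_le_card_orbits_prod [Fintype (orbitRel.Quotient G (X × X))] {a b : X} (hab : a ≠ b) :
    2 ≤ Fintype.card (orbitRel.Quotient G (X × X)) := by
  classical
  let qa : orbitRel.Quotient G (X × X) := Quotient.mk (orbitRel G (X × X)) (a, a)
  let qb : orbitRel.Quotient G (X × X) := Quotient.mk (orbitRel G (X × X)) (a, b)
  have hne : qa ≠ qb := by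
    intro h
    have h' : (a, a) ∈ orbit G (a, b) := by
      have := Quotient.exact h
      exact (orbitRel_apply).1 this
    obtain ⟨g, hg⟩ := h'
    have h1 : g • a = a := by simpa using congrArg Prod.fst hg
    have h2 : g • b = a := by simpa using congrArg Prod.snd hg
    exact hab (smul_left_cancel g (h1.trans h2.symm))
  have : Finset.card ({qa, qb} : Finset _) = 2 := Finset.card_pair hne
  calc 2 = Finset.card ({qa, qb} : Finset _) := this.symm
    _ ≤ Finset.card (Finset.univ) := Finset.card_le_card (Finset.subset_univ _)
    _ = Fintype.card _ := Finset.card_univ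

/-- LEMMA C (core).  For a transitive action of a finite group on a finite set with at least two
points, `2·∑_g |Fix g| ≤ ∑_g |Fix g|²`; equivalently `∑_g |Fix g|(|Fix g| - 1) ≥ ∑_g |Fix g| = |G|`:
weighting group elements by their number of fixed points, the average number of OTHER fixed points
is at least one. -/
theorem two_mul_sum_card_fixedBy_le_sum_sq [Fintype G] [Fintype X] [IsPretransitive G X]
    [∀ g : G, Fintype (fixedBy X g)] [∀ g : G, Fintype (fixedBy (X × X) g)]
    [Fintype (orbitRel.Quotient G X)] [Fintype (orbitRel.Quotient G (X × X))]
    {a b : X} (hab : a ≠ b) :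
    2 * ∑ g : G, Fintype.card (fixedBy X g) ≤ ∑ g : G, Fintype.card (fixedBy X g) ^ 2 := by
  have hX := sum_card_fixedBy_eq_card_orbits_mul_card_group G X
  have hXX := sum_card_fixedBy_eq_card_orbits_mul_card_group G (X × X)
  have h1 : Fintype.card (orbitRel.Quotient G X) = 1 := by
    rw [Fintype.card_eq_one_iff]
    refine ⟨Quotient.mk _ a, fun q => ?_⟩
    induction q using Quotient.inductionOn with
    | h x =>
      apply Quotient.sound
      exact (orbitRel_apply).2 (mem_orbit_iff.2 (exists_smul_eq G a x))
  have h2 := two_le_card_orbits_prod G X hab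
  have hsq : ∑ g : G, Fintype.card (fixedBy X g) ^ 2 = ∑ g : G, Fintype.card (fixedBy (X × X) g) := by
    refine Finset.sum_congr rfl fun g _ => ?_
    rw [card_fixedBy_prod]
  rw [hsq, hXX, hX, h1, one_mul]
  calc 2 * Fintype.card G ≤ Fintype.card (orbitRel.Quotient G (X × X)) * Fintype.card G :=
        Nat.mul_le_mul_right _ h2
    _ = _ := rfl

end Summit.HodgeConjecture.Ring2AbelianAll.FibrePartners
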